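import Mathlib
import HarnessLib
import Summits.Langlands.Langlands.Theorems.MirrorPairReflectionMirrorCriterionPrelim
import Literature.NumberTheory.GaloisRepresentations.AbsolutelyIrreducibleReduction
import Literature.NumberTheory.GaloisRepresentations.ResidualGaloisRepOpenKernel
import Literature.NumberTheory.GaloisRepresentations.TeichmullerLiftMonomial

/-!
# `MirrorPairReflection.MirrorCriterion` — the Ribet endpoint over `ℤ̄_p` (support file 2/2 for stmt-Langlands-12835)

**`core`.**  Let `G` be a compact group, `σ : G → GL₂(ℚ̄_p)` continuous and irreducible, `A`, `B`
integral characters with `tr σ ≡ A + B` modulo the open unit ball and `A(g₀) ≢ B(g₀)` for some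
`g₀` (and `p ≠ 2`, i.e. `‖2‖ = 1`).  Then there is a frame `P` in which `σ` is `ℤ̄_p`-integral,
`σ = P ρ₀ P⁻¹`, with `ρ₀` upper triangular modulo `𝔪`, diagonal `≡ (A, B)`, `ρ₀(g₀)₀₁ = 0`,
and `ρ₀(g₁)₀₁ = 1` for some `g₁` — Ribet's lattice with non-split reduction having the `A`-line
stable, constructed without choosing an a-priori lattice and without Brauer–Nesbitt:
1. (`exists_diagonal_frame`) conjugate so that `M = Q₀⁻¹ σ Q₀` has `M(g₀) = diag(l₁, l₂)`,
   `l₁ ≡ A(g₀)`, `l₂ ≡ B(g₀)`, `‖l₁ - l₂‖ = 1`;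
2. the generalised-matrix-algebra identities
   `(l₁ - l₂) M(g)_{i0} M(h)_{0j} = M(g g₀ h)_{ij} - l₂ M(g h)_{ij}` (and the mirror one),
   evaluated where `|M_{00}|` resp. `|M_{11}|` is maximal (`G` compact), show the diagonal entries
   are integral and `|M(g)_{01}| |M(h)_{10}| ≤ 1`;
3. irreducibility gives `M_{01} ≢ 0`; rescaling by `diag(1, γ⁻¹)` with `γ = M(g₁)_{01}` of
   maximal norm makes everything integral with `M₁(g₁)_{01} = 1`;
4. comparing `tr M₁(g g₀) = l₁ M₁(g)_{00} + l₂ M₁(g)_{11}` with `tr M₁(g)` gives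
   `M₁(g)_{00} ≡ A(g)`, `M₁(g)_{11} ≡ B(g)`, and multiplicativity of the `(0,0)` entry at
   `g₁ h` gives `M₁(h)_{10} ∈ 𝔪`.
Ref: K. Ribet, Invent. Math. 34 (1976), Prop. 2.1; J. Bellaïche – G. Chenevier, Astérisque 324
(2009), §1.5. No definitions, no named facts. (decomp-langlands lens-6, g44.)
-/

set_option linter.dupNamespace false -- project-wide option (lakefile weak.linter.dupNamespace); `Summit.Langlands.Langlands` is the mandated namespace

noncomputable section

namespace Summit.Langlands.Langlands.Theorems.MirrorPairReflectionMirrorCriterion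

open IsLocalRing
open Literature.NumberTheory.GaloisRepresentations
open scoped MatrixGroups Matrix

section Core

variable {p : ℕ} [Fact p.Prime]

/-! `mem_max_iff` / `residue_eq_residue_iff` of the kit are the Literature lemmas
`mem_maximalIdeal_padicAlgClIntegers_iff_norm_lt_one` / `residue_eq_residue_iff_norm_sub_lt_one`
(`TeichmullerLiftMonomial`, imported; census dedup remedy). -/

/-- **The endpoint.**  For a compact group `G`, an irreducible `σ : G → GL₂(ℚ̄_p)` whose trace is
congruent to `A + B` for two integral-valued characters `A, B` separated at some `g₀`, there is a

frame `P` in which `σ` is integral with reduction upper triangular, diagonal `≡ (A, B)`, diagonal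
with distinct entries at `g₀` and with entry `(0,1)` equal to `1` at some `g₁`. [folklore] -/
theorem core {G : Type*} [Group G] [TopologicalSpace G] [CompactSpace G]
    (σ : G →ₜ* GL (Fin 2) (PadicAlgCl p)) (A B : G →* PadicAlgCl p)
    (hA : ∀ g, ‖A g‖ ≤ 1) (hB : ∀ g, ‖B g‖ ≤ 1) (h2 : ‖(2 : PadicAlgCl p)‖ = 1)
    {g₀ : G} (hg₀ : ‖A g₀ - B g₀‖ = 1)
    (hT : ∀ g, ‖(σ g).val.trace - (A g + B g)‖ < 1) (hI : FramedRep.IsIrreducible σ) :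
    ∃ (P : GL (Fin 2) (PadicAlgCl p)) (ρ₀ : G →* GL (Fin 2) (padicAlgClIntegers p)) (g₁ : G),
      (∀ g, Matrix.GeneralLinearGroup.map (padicAlgClIntegers p).subtype (ρ₀ g) = P⁻¹ * σ g * P) ∧
      (∀ g, ‖(((ρ₀ g).val 1 0 : padicAlgClIntegers p) : PadicAlgCl p)‖ < 1) ∧
      (∀ g, ‖(((ρ₀ g).val 0 0 : padicAlgClIntegers p) : PadicAlgCl p) - A g‖ < 1) ∧
      (∀ g, ‖(((ρ₀ g).val 1 1 : padicAlgClIntegers p) : PadicAlgCl p) - B g‖ < 1) ∧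
      (((ρ₀ g₀).val 0 1 : padicAlgClIntegers p) : PadicAlgCl p) = 0 ∧
      (((ρ₀ g₁).val 0 1 : padicAlgClIntegers p) : PadicAlgCl p) = 1 := by
  classical
  classical
  /- 1–3. an eigen-frame at `g₀` (`exists_diagonal_frame`) -/
  obtain ⟨Q₀, l₁, l₂, hl1, hl2, hl₁A, hl₂B, hl12, hNQ'⟩ :=
    exists_diagonal_frame σ.toMonoidHom A B hA hB h2 hg₀ (fun g => hT g)
  have hNQ : (σ g₀).val * Q₀.val = Q₀.val * Matrix.diagonal ![l₁, l₂] := hNQ'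
  have hl21 : ‖l₂ - l₁‖ = 1 := by rw [norm_sub_rev]; exact hl12
  have hl12ne : l₁ ≠ l₂ := by
    intro h; rw [h, sub_self, norm_zero] at hl12; exact zero_ne_one hl12
  /- 4. the conjugate `M = Q₀⁻¹ σ Q₀` with `M g₀ = diag(l₁, l₂)` -/
  obtain ⟨M, hM⟩ : ∃ M : G →* GL (Fin 2) (PadicAlgCl p), ∀ g, M g = Q₀⁻¹ * σ g * Q₀ :=
    ⟨(MulAut.conj Q₀⁻¹).toMonoidHom.comp σ.toMonoidHom, fun g => by simp⟩
  have hMg₀ : (M g₀).val = Matrix.diagonal ![l₁, l₂] := by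
    rw [hM, Units.val_mul, Units.val_mul, Matrix.mul_assoc, hNQ, ← Matrix.mul_assoc,
      Units.inv_mul, Matrix.one_mul]
  have hMg₀00 : (M g₀).val 0 0 = l₁ := by rw [hMg₀]; simp
  have hMg₀01 : (M g₀).val 0 1 = 0 := by rw [hMg₀]; simp
  have hMg₀10 : (M g₀).val 1 0 = 0 := by rw [hMg₀]; simp
  have hMg₀11 : (M g₀).val 1 1 = l₂ := by rw [hMg₀]; simp
  -- the GMA identities
  have star1 : ∀ g h (i j : Fin 2), (l₁ - l₂) * ((M g).val i 0 * (M h).val 0 j) =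
      (M (g * g₀ * h)).val i j - l₂ * (M (g * h)).val i j := by
    intro g h i j
    simp only [map_mul, Units.val_mul, Matrix.mul_apply, Fin.sum_univ_two, hMg₀00, hMg₀01,
      hMg₀10, hMg₀11]
    ring
  have star2 : ∀ g h (i j : Fin 2), (l₂ - l₁) * ((M g).val i 1 * (M h).val 1 j) =
      (M (g * g₀ * h)).val i j - l₁ * (M (g * h)).val i j := by
    intro g h i j
    simp only [map_mul, Units.val_mul, Matrix.mul_apply, Fin.sum_univ_two, hMg₀00, hMg₀01,
      hMg₀10, hMg₀11]
    ring
  /- 5. compactness: entries attain their sup; diagonal entries are integral -/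
  have hcont : ∀ i j : Fin 2, Continuous fun g => (M g).val i j := by
    intro i j
    have e : (fun g => (M g).val i j) =
        fun g => ((Q₀⁻¹).val * (σ g).val * Q₀.val) i j := by
      funext g; rw [hM, Units.val_mul, Units.val_mul]
    rw [e]
    exact ((continuous_const.matrix_mul (Units.continuous_val.comp (map_continuous σ))).matrix_mul
      continuous_const).matrix_elem i j
  have hsup : ∀ i j : Fin 2, ∃ g', ∀ g, ‖(M g).val i j‖ ≤ ‖(M g').val i j‖ := by
    intro i j
    obtain ⟨g', -, hg'⟩ := isCompact_univ.exists_isMaxOn ⟨1, Set.mem_univ _⟩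
      ((continuous_norm.comp (hcont i j)).continuousOn)
    exact ⟨g', fun g => (isMaxOn_iff.1 hg') g (Set.mem_univ g)⟩
  have sq_le : ∀ {s : ℝ}, 0 ≤ s → s * s ≤ s → s ≤ 1 := by
    intro s hs h
    by_contra hh
    push Not at hh
    have := lt_mul_of_one_lt_right (zero_lt_one.trans hh) hh
    linarith
  have ha1 : ∀ g, ‖(M g).val 0 0‖ ≤ 1 := by
    obtain ⟨g', hg'⟩ := hsup 0 0
    have key := congrArg norm (star1 g' g' 0 0)
    rw [norm_mul, norm_mul, hl12, one_mul] at key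
    have hs : ‖(M g').val 0 0‖ * ‖(M g').val 0 0‖ ≤ ‖(M g').val 0 0‖ := by
      rw [key]
      refine (norm_sub_le_max' _ _).trans (max_le (hg' _) ?_)
      rw [norm_mul]
      exact (mul_le_of_le_one_left (norm_nonneg _) hl2).trans (hg' _)
    exact fun g => (hg' g).trans (sq_le (norm_nonneg _) hs)
  have hd1 : ∀ g, ‖(M g).val 1 1‖ ≤ 1 := by
    obtain ⟨g', hg'⟩ := hsup 1 1
    have key := congrArg norm (star2 g' g' 1 1)
    rw [norm_mul, norm_mul, hl21, one_mul] at key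
    have hs : ‖(M g').val 1 1‖ * ‖(M g').val 1 1‖ ≤ ‖(M g').val 1 1‖ := by
      rw [key]
      refine (norm_sub_le_max' _ _).trans (max_le (hg' _) ?_)
      rw [norm_mul]
      exact (mul_le_of_le_one_left (norm_nonneg _) hl1).trans (hg' _)
    exact fun g => (hg' g).trans (sq_le (norm_nonneg _) hs)
  have hbc : ∀ g h, ‖(M g).val 0 1‖ * ‖(M h).val 1 0‖ ≤ 1 := by
    intro g h
    have key := congrArg norm (star2 g h 0 0)
    rw [norm_mul, norm_mul, hl21, one_mul] at key
    rw [key]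
    refine (norm_sub_le_max' _ _).trans (max_le (ha1 _) ?_)
    rw [norm_mul]
    exact (mul_le_of_le_one_left (norm_nonneg _) hl1).trans (ha1 _)
  /- 6. irreducibility: the off-diagonal entries do not vanish identically -/
  have hQcol : ∀ (w : Fin 2 → PadicAlgCl p) (g : G),
      (σ g).val *ᵥ (Q₀.val *ᵥ w) = Q₀.val *ᵥ ((M g).val *ᵥ w) := by
    intro w g
    rw [Matrix.mulVec_mulVec, Matrix.mulVec_mulVec, hM, Units.val_mul, Units.val_mul,
      ← Matrix.mul_assoc, ← Matrix.mul_assoc, Units.mul_inv, Matrix.one_mul]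
  have hcol_ne : ∀ j : Fin 2, Q₀.val *ᵥ Pi.single j 1 ≠ 0 := by
    intro j h
    have h' := congrArg (fun w => (Q₀⁻¹).val *ᵥ w) h
    simp only [Matrix.mulVec_mulVec, Matrix.mulVec_zero] at h'
    rw [← Units.val_mul, inv_mul_cancel, Units.val_one, Matrix.one_mulVec] at h'
    have h'' := congrFun h' j
    simp at h''
  have hb_ne : ∃ g, (M g).val 0 1 ≠ 0 := by
    by_contra hzero
    push Not at hzero
    refine not_irreducible_of_stable_line σ (v := Q₀.val *ᵥ Pi.single 1 1)
      (hcol_ne 1) (fun g => ⟨(M g).val 1 1, ?_⟩) hI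
    rw [hQcol, ← Matrix.mulVec_smul]
    congr 1
    ext i
    fin_cases i <;> simp [Matrix.mulVec, dotProduct, hzero g, Pi.single_apply]
  /- 7. the rescaled frame: `γ = M(g₁)₀₁` of maximal norm, `D = diag(1, γ⁻¹)` -/
  obtain ⟨g₁, hg₁⟩ := hsup 0 1
  obtain ⟨gb, hgb⟩ := hb_ne
  have hγ : (M g₁).val 0 1 ≠ 0 := by
    intro h
    have := hg₁ gb
    rw [h, norm_zero] at this
    exact hgb (norm_le_zero_iff.1 this)
  obtain ⟨D, hD, hDinv⟩ : ∃ D : GL (Fin 2) (PadicAlgCl p),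
      D.val = Matrix.diagonal ![1, ((M g₁).val 0 1)⁻¹] ∧
        (D⁻¹).val = Matrix.diagonal ![1, (M g₁).val 0 1] := by
    refine ⟨⟨Matrix.diagonal ![1, ((M g₁).val 0 1)⁻¹], Matrix.diagonal ![1, (M g₁).val 0 1],
      ?_, ?_⟩, rfl, rfl⟩
    · rw [Matrix.diagonal_mul_diagonal, ← Matrix.diagonal_one]
      congr 1
      funext i; fin_cases i <;> simp [hγ]
    · rw [Matrix.diagonal_mul_diagonal, ← Matrix.diagonal_one]
      congr 1
      funext i; fin_cases i <;> simp [hγ]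
  obtain ⟨M₁, hM₁⟩ : ∃ M₁ : G →* GL (Fin 2) (PadicAlgCl p), ∀ g, M₁ g = D⁻¹ * M g * D :=
    ⟨(MulAut.conj D⁻¹).toMonoidHom.comp M, fun g => by simp⟩
  have hM₁P : ∀ g, M₁ g = (Q₀ * D)⁻¹ * σ g * (Q₀ * D) := fun g => by
    rw [hM₁, hM, mul_inv_rev]; simp only [mul_assoc]
  have hM₁e : ∀ g (i j : Fin 2), (M₁ g).val i j =
      (![1, (M g₁).val 0 1] : Fin 2 → PadicAlgCl p) i * (M g).val i j *
        (![1, ((M g₁).val 0 1)⁻¹] : Fin 2 → PadicAlgCl p) j := by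
    intro g i j
    rw [hM₁, Units.val_mul, Units.val_mul, hD, hDinv, Matrix.mul_diagonal, Matrix.diagonal_mul]
  have e00 : ∀ g, (M₁ g).val 0 0 = (M g).val 0 0 := fun g => by
    rw [hM₁e]; simp
  have e01 : ∀ g, (M₁ g).val 0 1 = (M g).val 0 1 * ((M g₁).val 0 1)⁻¹ := fun g => by
    rw [hM₁e]; simp
  have e10 : ∀ g, (M₁ g).val 1 0 = (M g₁).val 0 1 * (M g).val 1 0 := fun g => by
    rw [hM₁e]; simp
  have e11 : ∀ g, (M₁ g).val 1 1 = (M g).val 1 1 := fun g => by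
    rw [hM₁e]
    simp only [Fin.isValue, Matrix.cons_val_one, Matrix.cons_val_zero]
    field_simp
  -- integrality of `M₁`
  have i00 : ∀ g, ‖(M₁ g).val 0 0‖ ≤ 1 := fun g => by rw [e00]; exact ha1 g
  have i11 : ∀ g, ‖(M₁ g).val 1 1‖ ≤ 1 := fun g => by rw [e11]; exact hd1 g
  have i01 : ∀ g, ‖(M₁ g).val 0 1‖ ≤ 1 := fun g => by
    rw [e01, norm_mul, norm_inv]
    exact mul_inv_le_one_of_le₀ (hg₁ g) (norm_nonneg _)
  have i10 : ∀ g, ‖(M₁ g).val 1 0‖ ≤ 1 := fun g => by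
    rw [e10, norm_mul]; exact hbc g₁ g
  have hM₁g₀01 : (M₁ g₀).val 0 1 = 0 := by rw [e01, hMg₀01, zero_mul]
  have hM₁g₀10 : (M₁ g₀).val 1 0 = 0 := by rw [e10, hMg₀10, mul_zero]
  have hM₁g₀00 : (M₁ g₀).val 0 0 = l₁ := by rw [e00, hMg₀00]
  have hM₁g₀11 : (M₁ g₀).val 1 1 = l₂ := by rw [e11, hMg₀11]
  have hM₁g₁ : (M₁ g₁).val 0 1 = 1 := by rw [e01, mul_inv_cancel₀ hγ]
  /- 8. residual diagonal characters -/
  have htr₁ : ∀ g, (M₁ g).val.trace = (σ g).val.trace := fun g => by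
    rw [hM₁P, Units.val_mul, Units.val_mul, Matrix.trace_units_conj']
  have hdiagtr : ∀ g, (M₁ (g * g₀)).val.trace = (M₁ g).val 0 0 * l₁ + (M₁ g).val 1 1 * l₂ := by
    intro g
    rw [map_mul, Units.val_mul, Matrix.trace_fin_two, Matrix.mul_apply, Matrix.mul_apply,
      Fin.sum_univ_two, Fin.sum_univ_two, hM₁g₀00, hM₁g₀01, hM₁g₀10, hM₁g₀11]
    ring
  have hchar : ∀ g, ‖(M₁ g).val 0 0 - A g‖ < 1 ∧ ‖(M₁ g).val 1 1 - B g‖ < 1 := by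
    intro g
    have E1 : ‖((M₁ g).val 0 0 * l₁ + (M₁ g).val 1 1 * l₂) - (A g * l₁ + B g * l₂)‖ < 1 := by
      rw [← hdiagtr, htr₁]
      refine cong_trans (hT (g * g₀)) ?_
      rw [map_mul, map_mul]
      exact cong_add (cong_mul (hA g) hl1 (by simp) (cong_symm hl₁A))
        (cong_mul (hB g) hl2 (by simp) (cong_symm hl₂B))
    have E2 : ‖((M₁ g).val 0 0 + (M₁ g).val 1 1) - (A g + B g)‖ < 1 := by
      rw [← Matrix.trace_fin_two, htr₁]; exact hT g
    have hx : ‖(M₁ g).val 0 0 - A g‖ < 1 := by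
      have e : ((M₁ g).val 0 0 - A g) * (l₁ - l₂) =
          (((M₁ g).val 0 0 * l₁ + (M₁ g).val 1 1 * l₂) - (A g * l₁ + B g * l₂)) -
            (((M₁ g).val 0 0 + (M₁ g).val 1 1) - (A g + B g)) * l₂ := by ring
      have hn : ‖((M₁ g).val 0 0 - A g) * (l₁ - l₂)‖ < 1 := by
        rw [e]
        refine norm_sub_lt_one E1 ?_
        rw [norm_mul]
        exact mul_lt_one_of_nonneg_of_lt_one_left (norm_nonneg _) E2 hl2
      rwa [norm_mul, hl12, mul_one] at hn
    refine ⟨hx, ?_⟩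
    have e : (M₁ g).val 1 1 - B g =
        (((M₁ g).val 0 0 + (M₁ g).val 1 1) - (A g + B g)) - ((M₁ g).val 0 0 - A g) := by ring
    rw [e]; exact norm_sub_lt_one E2 hx
  /- 9. the entry `(1,0)` reduces to `0` -/
  have hc₁ : ∀ h, ‖(M₁ h).val 1 0‖ < 1 := by
    intro h
    have emul : (M₁ (g₁ * h)).val 0 0 =
        (M₁ g₁).val 0 0 * (M₁ h).val 0 0 + (M₁ g₁).val 0 1 * (M₁ h).val 1 0 := by
      rw [map_mul, Units.val_mul, Matrix.mul_apply, Fin.sum_univ_two]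
    have E1 : ‖(M₁ (g₁ * h)).val 0 0 - A (g₁ * h)‖ < 1 := (hchar _).1
    have E2 : ‖(M₁ g₁).val 0 0 * (M₁ h).val 0 0 - A g₁ * A h‖ < 1 :=
      cong_mul (i00 g₁) (hA h) (hchar g₁).1 (hchar h).1
    have E3 := cong_sub E1 E2
    rw [map_mul A, sub_self, sub_zero, emul, hM₁g₁, one_mul, add_sub_cancel_left] at E3
    exact E3
  /- 10. the integral model -/
  have hint : ∀ g (i j : Fin 2), (M₁ g).val i j ∈ padicAlgClIntegers p := by
    intro g i j
    rw [padicAlgCl_mem_valuationSubring_iff]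
    fin_cases i <;> fin_cases j
    · exact i00 g
    · exact i01 g
    · exact i10 g
    · exact i11 g
  have hmem : ∀ g, M₁ g ∈ (Matrix.GeneralLinearGroup.map (padicAlgClIntegers p).subtype).range := by
    intro g
    rw [mem_range_generalLinearGroup_map_iff]
    exact ⟨hint g, fun i j => by rw [← map_inv]; exact hint g⁻¹ i j⟩
  obtain ⟨ρ₀, hρ₀⟩ := exists_monoidHom_map_eq M₁ hmem
  have hentry : ∀ g (i j : Fin 2),
      (((ρ₀ g).val i j : padicAlgClIntegers p) : PadicAlgCl p) = (M₁ g).val i j := by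
    intro g i j
    have := congrArg (fun X : GL (Fin 2) (PadicAlgCl p) => X.val i j) (hρ₀ g)
    simpa [Matrix.GeneralLinearGroup.map] using this
  refine ⟨Q₀ * D, ρ₀, g₁, fun g => by rw [hρ₀, hM₁P], fun g => ?_, fun g => ?_, fun g => ?_,
    ?_, ?_⟩
  · rw [hentry]; exact hc₁ g
  · rw [hentry]; exact (hchar g).1
  · rw [hentry]; exact (hchar g).2
  · rw [hentry]; exact hM₁g₀01
  · rw [hentry]; exact hM₁g₁


end Core

end Summit.Langlands.Langlands.Theorems.MirrorPairReflectionMirrorCriterion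

end
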